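import Summits.NavierStokesRegularity.FluidComputer.PalasekTowerGermHostAnchor
import Summits.NavierStokesRegularity.FluidComputer.PalasekTowerGermHostForce
import Summits.NavierStokesRegularity.FluidComputer.PalasekTowerBoxSchedule
import Summits.NavierStokesRegularity.FluidComputer.PalasekTowerRegisterGlobalDesignExact

/-!
# The germ host, III: HOST PREPARATION FOR EVERY NAMED PROFILE — `HostPreparationD (HostClass.exact (germ schedule))`

Cell `ns-blowup`, seat `ns-blowup-ecbridge-3` (g3); GROUP C «BRIDGE SUPPORT» of the route
`PalasekTowerBreakdown` (crux `EpisodeBaseG`, item stmt-NavierStokesRegularity-19179). R2 of record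
(planner 2026-08-26): the crux is `∃ S*, HostPreparationD (HostClass.exact S*) ∧ FirstEpisodeD (HostClass.exact S*)`
(`episodeBaseG_iff_exists_exact`) for a NAMED design `S*`. LABEL: E–C typing (KERNEL construction:
a typed design slot + the prescribed level-`0` host of every design filling it). WHAT THIS IS NOT:
not Navier–Stokes evidence — the host below is a PRESCRIBED flow (its force is its own NS residual,
free before the readout as the register allows); nothing is said about what the Navier–Stokes flow
does after `τ₀`, about `FirstEpisodeD`, `EpisodeBaseG = RungG 1` or blow-up.

## The result

`LevelZeroData U ρ` is the DESIGN SLOT for a named seed profile `U : ℝ³ → ℝ³` (unit viscosity, wide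
rates): `U` smooth, divergence free, supported in `B̄(0, ρ)`, with the three LEVEL-`0` READOUTS —
speed `‖U‖ ≤ Y₀` everywhere, `= Y₀` attained in the ball (the GLOBAL ANCHOR makes the floor an exact
maximum, `Stage.norm_τ_zero_le`), strain `‖DU‖ ≥ A₀` in the ball, an `N₀`-core loop with circulation
`≥ N₀^{β−2}` — and the STRICT FIRST-ORDER ANCHOR TEST `⟪U(x), V(x)⟫ > 0` wherever `‖U(x)‖ = Y₀`,
`V = P(ΔU − (U·∇)U)` (to first order: the free NS flow through `U` is SPEEDING UP at every argmax —
snapshots of accelerating flows pass; relative equilibria and decaying flows fail).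
**`LevelZeroData.hostPreparationD_exact`**: for every such `U` and every push constant `c₄ ∈ (0, 1]`,
the GERM SCHEDULE `h.schedule c₄` — zero datum, force = faded NS residual of the line germ
`u(t) = αhost t • (U + σline σ₀ t • V)` (p438782, p441987), rigid window clock, radius `ρ` — is pinned
(`Λ = 8`, `θ = 6/5`), rigid and quiet and carries a globally anchored registered LEVEL-`0` STAGE whose
velocity IS the germ: `u(τ₀) = U`, `∂ₜu(τ₀) = V`, `f(τ₀) = 0`. So the first child of the R2 split is
discharged AT ONCE FOR EVERY NAMED GERM DESIGN; a design seat owes the slot (three readouts + one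
pointwise inequality) and then `FirstEpisodeD (HostClass.exact S*)` — the genuine episode. Necessity:
a line anchor forces `⟪U, V⟫ ≥ 0` on the argmax (`inner_accel_nonneg_of_line_anchor`).

References: S. Palasek, arXiv:2605.13827 §3.3–§4 (host preparation before the first readout; Step 2)
[cite: Palasek2026ElementaryModel, §3.3]; A. J. Majda, A. L. Bertozzi, *Vorticity and Incompressible
Flow* (CUP 2002), §1.8 Prop. 1.16 [cite: MajdaBertozziCUP2002, §1.8 Prop. 1.16]; C. L. Fefferman,
Clay problem description, (4)–(7) [cite: FeffermanClay2006, (4) (5) (6) (7)].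
-/

noncomputable section

namespace Summit.NavierStokesRegularity.FluidComputer.PalasekTowerClayBridge.Germ

open Set Function Filter Topology InnerProductSpace Metric MeasureTheory
open scoped Topology ContDiff RealInnerProductSpace ENNReal Laplacian

open Literature.Analysis.FluidPDE

/-! ## §1 The design slot: level-`0` readouts and the strict anchor test of a named profile -/

/-- **LEVEL-`0` DATA OF A NAMED PROFILE** (the design slot of the germ host, unit viscosity, wide-base
rates, register v2.3′): smooth, divergence free, supported in `B̄(0, ρ)`; speed `≤ Y₀` everywhere and
`= Y₀` somewhere in the ball; strain `≥ A₀` somewhere in the ball; an `N₀`-core loop in the ball with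
circulation `≥ N₀^{β−2}` (`CoreLedger` at level `0`, `c₁ = 1`); and the STRICT FIRST-ORDER ANCHOR TEST
`⟪U, P(ΔU − (U·∇)U)⟫ > 0` on the argmax of `‖U‖`. [cite: Palasek2026ElementaryModel, §3.3] -/
structure LevelZeroData (U : EuclideanSpace ℝ (Fin 3) → EuclideanSpace ℝ (Fin 3)) (ρ : ℝ) : Prop where
  /-- the profile is smooth -/
  smooth : ContDiff ℝ ∞ U
  /-- … supported in the closed ball of radius `ρ` -/
  support : tsupport U ⊆ closedBall 0 ρ
  /-- … and divergence free -/
  divFree : VectorCalculus.IsDivFree U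
  /-- speed ceiling `Y₀` everywhere (the anchor's value at the readout) -/
  ceiling : ∀ x, ‖U x‖ ≤ TowerRates.wide.Y 0
  /-- speed floor `Y₀` attained in the ball -/
  floor : ∃ x, ‖x‖ ≤ ρ ∧ TowerRates.wide.Y 0 ≤ ‖U x‖
  /-- strain floor `A₀` attained in the ball -/
  strain : ∃ x, ‖x‖ ≤ ρ ∧ TowerRates.wide.A 0 ≤ ‖fderiv ℝ U x‖
  /-- the level-`0` core loop: inside a `1/N₀`-ball centred in the ball, speed `≤ 8π/N₀`,
  circulation `≥ N₀^{β−2}` -/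
  core : ∃ (x : EuclideanSpace ℝ (Fin 3)) (γ : ℝ → EuclideanSpace ℝ (Fin 3)),
    ‖x‖ ≤ ρ ∧ ContDiff ℝ 1 γ ∧ γ 0 = γ 1 ∧
      (∀ s ∈ Icc (0 : ℝ) 1, γ s ∈ closedBall x (1 / TowerRates.wide.N 0)) ∧
      (∀ s ∈ Icc (0 : ℝ) 1, ‖deriv γ s‖ ≤ 8 * Real.pi / TowerRates.wide.N 0) ∧
      TowerRates.wide.N 0 ^ (TowerRates.wide.β - 2) ≤ circulation U γ
  /-- the strict first-order anchor test at the speed maximum -/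
  anchor : ∀ x, ‖U x‖ = TowerRates.wide.Y 0 → 0 < ⟪U x, accel 1 U x⟫

namespace LevelZeroData

variable {U : EuclideanSpace ℝ (Fin 3) → EuclideanSpace ℝ (Fin 3)} {ρ : ℝ} (h : LevelZeroData U ρ)
include h

/-- The profile has compact support. [folklore] -/
theorem hasCompactSupport : HasCompactSupport U :=
  (isCompact_closedBall (0 : EuclideanSpace ℝ (Fin 3)) ρ).of_isClosed_subset (isClosed_tsupport U)
    h.support

/-! ## §2 The width of the anchored segment and the fade length (choices) -/

/-- The anchored segment exists (strict test ⇒ line anchor, `exists_line_anchor`). [folklore] -/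
theorem exists_width : ∃ σ₀ : ℝ, 0 < σ₀ ∧
    ∀ σ : ℝ, -σ₀ < σ → σ < 0 → ∀ x, ‖U x + σ • accel 1 U x‖ < TowerRates.wide.Y 0 :=
  exists_line_anchor h.smooth h.hasCompactSupport Host.wide_Y_zero_pos h.ceiling h.anchor

/-- **The width `σ₀` of the anchored segment** (a choice). [folklore] -/
def width : ℝ := h.exists_width.choose

/-- `0 < σ₀`. [folklore] -/
theorem width_pos : 0 < h.width := h.exists_width.choose_spec.1

/-- The line anchor at width `σ₀`. [folklore] -/
theorem width_anchor : ∀ σ : ℝ, -h.width < σ → σ < 0 →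
    ∀ x, ‖U x + σ • accel 1 U x‖ < TowerRates.wide.Y 0 :=
  h.exists_width.choose_spec.2

/-- The fade length exists: after the matched instant `τ₀ = 1` the residual of the line germ stays
`≤ c₄ Y₀` for a while (`exists_window_norm_germResid_le`), and we may take that while `≤ w₀`.
[folklore] -/
theorem exists_fadeLen {c₄ : ℝ} (hc₄ : 0 < c₄) : ∃ ε : ℝ, 0 < ε ∧ ε ≤ Host.wfirst ∧
    ∀ t ∈ Icc (1 : ℝ) (1 + ε), ∀ x : EuclideanSpace ℝ (Fin 3),
      ‖germResid 1 U αhost (βhost h.width) t x‖ ≤ c₄ * TowerRates.wide.Y 0 := by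
  have hδ : 0 < c₄ * TowerRates.wide.Y 0 := mul_pos hc₄ Host.wide_Y_zero_pos
  obtain ⟨ε, hε, hwin⟩ := exists_window_norm_germResid_le (ν := 1) h.smooth h.hasCompactSupport
    contDiff_αhost (contDiff_βhost h.width) αhost_one deriv_αhost_one (βhost_one h.width)
    (deriv_βhost_one h.width_pos.ne') h.support hδ
  refine ⟨min ε Host.wfirst, lt_min hε Host.wfirst_pos, min_le_right _ _, fun t ht x => ?_⟩
  exact hwin t ⟨ht.1, ht.2.trans (by linarith [min_le_left ε Host.wfirst])⟩ x

/-- **The fade length `ε`** for the push constant `c₄` (a choice). [folklore] -/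
def fadeLen {c₄ : ℝ} (hc₄ : 0 < c₄) : ℝ := (h.exists_fadeLen hc₄).choose

/-- `0 < ε`. [folklore] -/
theorem fadeLen_pos {c₄ : ℝ} (hc₄ : 0 < c₄) : 0 < h.fadeLen hc₄ := (h.exists_fadeLen hc₄).choose_spec.1

/-- `ε ≤ w₀`. [folklore] -/
theorem fadeLen_le_wfirst {c₄ : ℝ} (hc₄ : 0 < c₄) : h.fadeLen hc₄ ≤ Host.wfirst :=
  (h.exists_fadeLen hc₄).choose_spec.2.1

/-- The residual is `≤ c₄ Y₀` on `[1, 1 + ε] × ℝ³`. [folklore] -/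
theorem fadeLen_window {c₄ : ℝ} (hc₄ : 0 < c₄) :
    ∀ t ∈ Icc (1 : ℝ) (1 + h.fadeLen hc₄), ∀ x : EuclideanSpace ℝ (Fin 3),
      ‖germResid 1 U αhost (βhost h.width) t x‖ ≤ c₄ * TowerRates.wide.Y 0 :=
  (h.exists_fadeLen hc₄).choose_spec.2.2

/-! ## §3 The velocity, pressure and force of the germ host -/

/-- **The velocity of the germ host**: the line germ `αhost t • (U + σline σ₀ t • V)`. [folklore] -/
def vel : ℝ → EuclideanSpace ℝ (Fin 3) → EuclideanSpace ℝ (Fin 3) := germ 1 U αhost (βhost h.width)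

/-- **The pressure of the germ host**: `β' π − β² |∇π|²/2`. [folklore] -/
def pres : ℝ → EuclideanSpace ℝ (Fin 3) → ℝ := germPres 1 U (βhost h.width)

/-- **The force of the germ host** for push constant `c₄`: the NS residual of the germ, faded out on
`[1, 1 + ε]`. [folklore] -/
def force {c₄ : ℝ} (hc₄ : 0 < c₄) : ℝ → EuclideanSpace ℝ (Fin 3) → EuclideanSpace ℝ (Fin 3) :=
  germForce 1 U αhost (βhost h.width) (1 + h.fadeLen hc₄) (h.fadeLen hc₄)

/-- The force is jointly smooth. [cite: FeffermanClay2006, (6)] -/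
theorem contDiff_uncurry_force {c₄ : ℝ} (hc₄ : 0 < c₄) : ContDiff ℝ ∞ (uncurry (h.force hc₄)) :=
  contDiff_uncurry_germForce h.smooth h.hasCompactSupport contDiff_αhost (contDiff_βhost _)

/-- The force has compact space-time support (box `[0, 1 + ε] × B̄(0, ρ)`). [cite: FeffermanClay2006, (5)] -/
theorem hasCompactSupport_force {c₄ : ℝ} (hc₄ : 0 < c₄) : HasCompactSupport (uncurry (h.force hc₄)) :=
  hasCompactSupport_germForce h.smooth h.hasCompactSupport (h.fadeLen_pos hc₄) h.support
    (fun _ ht => αhost_of_nonpos ht) (fun _ ht => βhost_of_nonpos ht)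

/-- The force vanishes from `τ₁ = 1 + w₀` on (indeed from `1 + ε` on). [folklore] -/
theorem force_eq_zero_of_ge {c₄ : ℝ} (hc₄ : 0 < c₄) :
    ∀ t, Host.τfirst ≤ t → ∀ x, h.force hc₄ t x = 0 := by
  intro t ht x
  have h1 : 1 + h.fadeLen hc₄ ≤ t := by
    rw [Host.τfirst_eq] at ht
    linarith [h.fadeLen_le_wfirst hc₄]
  exact germForce_eq_zero_of_ge (h.fadeLen_pos hc₄) h1 x

/-- The window bound: `‖force‖ ≤ c₄ Y₀` on `[1, τ₁]` (indeed at every `t ≥ 1`). [folklore] -/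
theorem norm_force_le {c₄ : ℝ} (hc₄ : 0 < c₄) :
    ∀ t ∈ Icc (1 : ℝ) Host.τfirst, ∀ x, ‖h.force hc₄ t x‖ ≤ c₄ * TowerRates.wide.Y 0 :=
  fun _ ht x => norm_germForce_le_of_window (h.fadeLen_pos hc₄)
    (mul_pos hc₄ Host.wide_Y_zero_pos).le (h.fadeLen_window hc₄) ht.1 x

/-- The force is confined to the ball. [folklore] -/
theorem force_eq_zero_of_norm_gt {c₄ : ℝ} (hc₄ : 0 < c₄) (t : ℝ) (x : EuclideanSpace ℝ (Fin 3))
    (hx : ρ < ‖x‖) : h.force hc₄ t x = 0 :=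
  germForce_eq_zero_of_norm_gt h.smooth h.hasCompactSupport h.support t hx

/-- On the host's slab `t ≤ 1` the force IS the residual of the germ. [folklore] -/
theorem force_eq_germResid {c₄ : ℝ} (hc₄ : 0 < c₄) {t : ℝ} (ht : t ≤ 1) (x : EuclideanSpace ℝ (Fin 3)) :
    h.force hc₄ t x = germResid 1 U αhost (βhost h.width) t x :=
  germForce_eq_germResid (h.fadeLen_pos hc₄) (by linarith) x

/-- **`f(τ₀) = 0`**: at the readout the force vanishes identically (the germ is matched). [folklore] -/
theorem force_one {c₄ : ℝ} (hc₄ : 0 < c₄) (x : EuclideanSpace ℝ (Fin 3)) : h.force hc₄ 1 x = 0 := by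
  rw [h.force_eq_germResid hc₄ le_rfl]
  exact germResid_eq_zero_of_matched αhost_one deriv_αhost_one (βhost_one _)
    (deriv_βhost_one h.width_pos.ne') x

/-! ## §4 The germ schedule -/

/-- **THE GERM SCHEDULE OF THE NAMED PROFILE** for push constant `c₄ ∈ (0, 1]`: the box schedule
(`Schedule.ofBox`) with zero datum, the faded germ force, radius `ρ`. [cite: Palasek2026ElementaryModel, §3.3] -/
def schedule (c₄ : ℝ) (hc₄ : 0 < c₄) (hc₄' : c₄ ≤ 1) : Schedule TowerRates.wide :=
  Schedule.ofBox 0 (h.force hc₄) ρ c₄ hc₄' contDiff_const HasCompactSupport.zero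
    (h.contDiff_uncurry_force hc₄) (h.hasCompactSupport_force hc₄) (h.force_eq_zero_of_ge hc₄)
    (h.norm_force_le hc₄)

section Schedule

variable {c₄ : ℝ} (hc₄ : 0 < c₄) (hc₄' : c₄ ≤ 1)

/-- The germ schedule is RIGID. [folklore] -/
theorem schedule_rigid : (h.schedule c₄ hc₄ hc₄').Rigid := Schedule.ofBox_rigid _ _ _ _ _ _ _

/-- The germ schedule is QUIET. [folklore] -/
theorem schedule_quiet : (h.schedule c₄ hc₄ hc₄').Quiet := Schedule.ofBox_quiet _ _ _ _ _ _ _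

/-- The germ schedule is PINNED (`Λ = 8`, `θ = 6/5`). [folklore] -/
theorem schedule_pins : (h.schedule c₄ hc₄ hc₄').Pins 8 (6 / 5) :=
  Schedule.ofBox_pins _ _ _ _ _ _ _ (fun _ _ => rfl) (h.force_eq_zero_of_norm_gt hc₄)

/-- `τ 0 = 1`. [folklore] -/
theorem schedule_τ_zero : (h.schedule c₄ hc₄ hc₄').τ 0 = 1 := Host.windowTime_zero

/-- The force of the germ schedule. [folklore] -/
theorem schedule_f : (h.schedule c₄ hc₄ hc₄').f = h.force hc₄ := rfl

/-- The radius of the germ schedule is `ρ`. [folklore] -/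
theorem schedule_radius : (h.schedule c₄ hc₄ hc₄').radius = ρ := rfl

/-- `c₁ = 1`. [folklore] -/
theorem schedule_c₁ : (h.schedule c₄ hc₄ hc₄').c₁ = 1 := rfl

/-- `c₂ = 5/3`. [folklore] -/
theorem schedule_c₂ : (h.schedule c₄ hc₄ hc₄').c₂ = 5 / 3 := rfl

/-! ## §5 The level-`0` stage: the germ -/

/-- **The germ solves forced Navier–Stokes with the schedule's force on the host's slab `[0, 1]`.**
[cite: FeffermanClay2006, (1) (2)] -/
theorem isClassicalNSSolutionOn_vel :
    IsClassicalNSSolutionOn (Icc 0 1) 1 (h.schedule c₄ hc₄ hc₄').f h.vel h.pres := by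
  have hb := isClassicalNSSolutionOn_germ (ν := 1) (α := αhost) (β := βhost h.width) h.smooth
    h.hasCompactSupport contDiff_αhost (contDiff_βhost _) h.divFree one_pos
  refine ⟨hb.smooth_velocity, hb.smooth_pressure, fun t ht x => ?_, hb.divFree⟩
  have hf : (h.schedule c₄ hc₄ hc₄').f t x = germResid 1 U αhost (βhost h.width) t x :=
    h.force_eq_germResid hc₄ ht.2 x
  rw [hf]
  exact hb.momentum t ht x

/-- The germ host starts from rest. [folklore] -/
theorem vel_zero : h.vel 0 = 0 := germ_line_zero 1 U h.width

/-- **`u(τ₀) = U`**: the germ host arrives at the named profile at the readout. [folklore] -/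
theorem vel_one : h.vel 1 = U := germ_line_one 1 U h.width

/-- **`∂ₜu(τ₀) = V`**: the germ host arrives with the NS acceleration of the profile. [folklore] -/
theorem timeDerivWithin_vel_one (x : EuclideanSpace ℝ (Fin 3)) :
    timeDerivWithin (Icc 0 1) h.vel 1 x = accel 1 U x := by
  rw [vel, timeDerivWithin_germ (contDiff_αhost.differentiable (by simp))
    ((contDiff_βhost _).differentiable (by simp)) one_pos ⟨zero_le_one, le_rfl⟩,
    deriv_αhost_one, deriv_βhost_one h.width_pos.ne', zero_smul, one_smul, zero_add]

/-- **THE GLOBAL ANCHOR**: `‖u(t, x)‖ < Y₀` for all `t < 1` and all `x`. [folklore] -/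
theorem norm_vel_lt {t : ℝ} (ht : t < 1) (x : EuclideanSpace ℝ (Fin 3)) :
    ‖h.vel t x‖ < TowerRates.wide.Y 0 :=
  norm_germ_lt h.width_pos h.width_anchor ht x

/-- The ceiling on the slab: `‖u(t, x)‖ ≤ Y₀` for `t ≤ 1`. [folklore] -/
theorem norm_vel_le {t : ℝ} (ht : t ≤ 1) (x : EuclideanSpace ℝ (Fin 3)) :
    ‖h.vel t x‖ ≤ TowerRates.wide.Y 0 :=
  norm_germ_le h.width_pos h.ceiling h.width_anchor ht x

/-- Finite energy on the slab. [cite: FeffermanClay2006, (7)] -/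
theorem energy_vel : ∃ C : ℝ≥0∞, C < ⊤ ∧ ∀ t ∈ Icc (0 : ℝ) 1, ∫⁻ x, ‖h.vel t x‖ₑ ^ 2 ≤ C :=
  energy_germ (ν := 1) h.smooth h.hasCompactSupport (fun t _ => abs_αhost_le_one t)
    (fun _ ht => abs_βhost_le h.width_pos ht.2)

/-- **THE LEVEL-`0` STAGE OF THE GERM SCHEDULE**: exact classical forced Navier–Stokes on `[0, 1]`,
zero datum, finite energy, the level-`0` floor / ceiling, and the route margin `routeG` — strain floor,
the GLOBAL ANCHOR, rigidity, the core ledger — all read off the named profile `U = u(τ₀)`.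
[cite: Palasek2026ElementaryModel, §3.3] -/
theorem stage : Nonempty (Stage 1 TowerRates.wide (h.schedule c₄ hc₄ hc₄')
    (Margins.routeG TowerRates.wide) 0) := by
  have hτ0 : (h.schedule c₄ hc₄ hc₄').τ 0 = 1 := h.schedule_τ_zero hc₄ hc₄'
  have hY := Host.wide_Y_zero_pos
  have henergy : ∃ C : ℝ≥0∞, C < ⊤ ∧ ∀ t ∈ Icc 0 ((h.schedule c₄ hc₄ hc₄').τ 0),
      ∫⁻ x, ‖h.vel t x‖ₑ ^ 2 ≤ C := by
    rw [hτ0]; exact h.energy_vel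
  have hcl : IsClassicalNSSolutionOn (Icc 0 ((h.schedule c₄ hc₄ hc₄').τ 0)) 1
      (h.schedule c₄ hc₄ hc₄').f h.vel h.pres := by
    rw [hτ0]; exact h.isClassicalNSSolutionOn_vel hc₄ hc₄'
  refine ⟨{ u := h.vel, p := h.pres, classical := hcl, initial := ?_, energy := henergy,
            floor := ?_, ceiling := ?_, quiet := ?_, margin := ?_ }⟩
  · rw [h.vel_zero]; rfl
  · intro j hj
    obtain rfl := Nat.le_zero.1 hj
    obtain ⟨x, hx, hfl⟩ := h.floor
    refine ⟨x, hx, ?_⟩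
    rw [hτ0, schedule_c₁, one_mul, h.vel_one]
    exact hfl
  · intro j hj t ht x
    obtain rfl := Nat.le_zero.1 hj
    rw [hτ0] at ht
    rw [schedule_c₂]
    have := h.norm_vel_le ht.2 x
    linarith
  · intro j hj
    exact absurd hj (by omega)
  · show (∀ j, j ≤ 0 → ∃ x, ‖x‖ ≤ (h.schedule c₄ hc₄ hc₄').radius ∧
        (h.schedule c₄ hc₄ hc₄').c₁ * TowerRates.wide.A j ≤
          ‖fderiv ℝ (h.vel ((h.schedule c₄ hc₄ hc₄').τ j)) x‖) ∧
      ((h.schedule c₄ hc₄ hc₄').AnchorGlobal h.vel ∧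
        ((h.schedule c₄ hc₄ hc₄').Rigid ∧
          CoreLedger TowerRates.wide (h.schedule c₄ hc₄ hc₄') 0 h.vel))
    refine ⟨?_, ?_, h.schedule_rigid hc₄ hc₄', ?_⟩
    · intro j hj
      obtain rfl := Nat.le_zero.1 hj
      obtain ⟨x, hx, hst⟩ := h.strain
      refine ⟨x, hx, ?_⟩
      rw [hτ0, schedule_c₁, one_mul, h.vel_one]
      exact hst
    · intro t ht x
      rw [hτ0] at ht
      rw [schedule_c₁, one_mul]
      exact h.norm_vel_lt ht.2 x
    · intro j hj
      obtain rfl := Nat.le_zero.1 hj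
      obtain ⟨x, γ, hx, hγ, hcl', hball, hspeed, hcirc⟩ := h.core
      refine ⟨x, γ, hx, hγ, hcl', hball, hspeed, ?_⟩
      rw [hτ0, schedule_c₁, one_mul, h.vel_one]
      exact hcirc

/-! ## §6 Host preparation for the named profile -/

/-- **HOST PREPARATION IN THE SINGLETON CLASS OF THE GERM SCHEDULE** — the first child of the R2 split
of `EpisodeBaseG` (item stmt-NavierStokesRegularity-19179), for EVERY named profile filling the slot
`LevelZeroData` and every push constant `c₄ ∈ (0, 1]`. [cite: Palasek2026ElementaryModel, §3.3] -/
theorem hostPreparationD_exact : HostPreparationD (HostClass.exact (h.schedule c₄ hc₄ hc₄')) :=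
  (hostPreparationD_exact_iff _).2
    ⟨h.schedule_pins hc₄ hc₄', h.schedule_rigid hc₄ hc₄', h.schedule_quiet hc₄ hc₄', h.stage hc₄ hc₄'⟩

/-- **The crux for this design reduces to its episode**: `FirstEpisodeD` over the singleton class of the
germ schedule gives `EpisodeBaseG` (`episodeBaseG_of_exact`). [cite: Palasek2026ElementaryModel, §4] -/
theorem episodeBaseG_of_firstEpisodeD
    (hF : FirstEpisodeD (HostClass.exact (h.schedule c₄ hc₄ hc₄'))) : EpisodeBaseG :=
  episodeBaseG_of_exact _ (h.hostPreparationD_exact hc₄ hc₄') hF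

end Schedule

end LevelZeroData

/-! ## §7 Necessity: a line anchor forces the non-strict test -/

/-- **The strict test is the sharp form of a necessary condition**: if the segment `U + σV`,
`−σ₀ < σ < 0`, stays strictly below `Y` in sup-norm and `‖U(x₀)‖ = Y`, then `⟪U(x₀), V(x₀)⟫ ≥ 0`
(`‖U + σV‖² − ‖U‖² = σ(2⟪U,V⟫ + σ‖V‖²) < 0` for all small `σ < 0`). [folklore] -/
theorem inner_accel_nonneg_of_line_anchor {ν : ℝ}
    {U : EuclideanSpace ℝ (Fin 3) → EuclideanSpace ℝ (Fin 3)} {Y σ₀ : ℝ} (hσ₀ : 0 < σ₀)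
    (hline : ∀ σ : ℝ, -σ₀ < σ → σ < 0 → ∀ x, ‖U x + σ • accel ν U x‖ < Y)
    {x₀ : EuclideanSpace ℝ (Fin 3)} (hx₀ : ‖U x₀‖ = Y) : 0 ≤ ⟪U x₀, accel ν U x₀⟫ := by
  set V := accel ν U x₀ with hV
  set g := ⟪U x₀, V⟫ with hg
  by_contra hneg
  rw [not_le] at hneg
  -- choose `σ < 0` with `|σ| < σ₀` and `|σ| ‖V‖² < -2g`
  set σ := -min (σ₀ / 2) (-g / (‖V‖ ^ 2 + 1)) with hσ
  have hm : 0 < min (σ₀ / 2) (-g / (‖V‖ ^ 2 + 1)) := lt_min (by linarith) (by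
    apply div_pos (by linarith); positivity)
  have hσneg : σ < 0 := by rw [hσ]; linarith
  have hσlow : -σ₀ < σ := by
    rw [hσ]
    have := min_le_left (σ₀ / 2) (-g / (‖V‖ ^ 2 + 1))
    linarith
  have hY0 : 0 ≤ Y := by rw [← hx₀]; exact norm_nonneg _
  have hlt := hline σ hσlow hσneg x₀
  have hsq : ‖U x₀ + σ • V‖ ^ 2 < Y ^ 2 := by
    have := pow_lt_pow_left₀ hlt (norm_nonneg _) two_ne_zero
    exact this
  rw [norm_add_smul_sq, hx₀] at hsq
  -- `2σ g + σ² ‖V‖² < 0`, i.e. `(-σ)(−2g − (−σ)‖V‖²) < 0`; but `(−σ)‖V‖² ≤ (−σ)(‖V‖²+1) ≤ −g`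
  have h1 : -σ ≤ -g / (‖V‖ ^ 2 + 1) := by
    rw [hσ, neg_neg]; exact min_le_right _ _
  have h2 : -σ * (‖V‖ ^ 2 + 1) ≤ -g := by
    rwa [le_div_iff₀ (by positivity)] at h1
  nlinarith [sq_nonneg ‖V‖, sq_nonneg σ]

/-- … in particular the width chosen for a profile in the slot is consistent: at every argmax point the
NS acceleration does not point inwards (trivially, since the slot asks for the strict inequality; recorded
as the converse direction of the construction). [folklore] -/
theorem LevelZeroData.inner_accel_nonneg {U : EuclideanSpace ℝ (Fin 3) → EuclideanSpace ℝ (Fin 3)}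
    {ρ : ℝ} (h : LevelZeroData U ρ) {x₀ : EuclideanSpace ℝ (Fin 3)}
    (hx₀ : ‖U x₀‖ = TowerRates.wide.Y 0) : 0 ≤ ⟪U x₀, accel 1 U x₀⟫ :=
  inner_accel_nonneg_of_line_anchor h.width_pos h.width_anchor hx₀

end Summit.NavierStokesRegularity.FluidComputer.PalasekTowerClayBridge.Germ

end
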